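import Mathlib
import Summits.NavierStokesRegularity.NavierStokesRegularity.Theorems.LandauTailLandauTailBlowupShellError

/-!
# Crux `LandauTail.LandauTailBlowup` (stmt-NavierStokesRegularity-1944), line `registered`, cycle c7:
  stub `landauTail_shell_enstrophy_floor` — the SHELL THEOREM, enstrophy form

Helper file on the proof path of the crux item `stmt-NavierStokesRegularity-1944`
(`Summit.NavierStokesRegularity.NavierStokesRegularity.Theses.LandauTail.LandauTailBlowup`), lead c7: the
registered support stub `landauTail_shell_enstrophy_floor` (L3), composed from the exact local momentum law
(`landauTail_momentum_law`, p173098), the plateau test with its vector potential (`landauTail_exists_plateau_test`,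
p173017) and the vorticity-moment bound (`landauTail_vorticity_moment_bound`, p172805).

THEOREM. For a nonzero steady `(−1)`-homogeneous profile `(U, P)` smooth off the origin (a Landau solution) there
are `c, ε > 0` such that every classical unit-viscosity flow `v` on `ℝ³ × (−1,0)` which is `L²`-close to the Landau
flow on a shell, `∫_{s₁}^{s₂}∫_{ρ/2<|y|<ρ} |v − U|² ≤ ε ρ (s₂ − s₁)`, DISSIPATES inside the shell:
`∫_{s₁}^{s₂}∫_{B_ρ} |∇v|² ≥ c (s₂ − s₁)³ ρ⁻⁵`.

PROOF. The momentum law `M′ = −β + E` with `∫|E| ≤ β(s₂−s₁)/8` pins `M(t)` within `β(s₂−s₁)/8` of the line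
`M(s₁) − β(t − s₁)`, which has modulus `≥ β(s₂−s₁)/4` on a quarter of the window; there `|M| ≥ β(s₂−s₁)/8`.
But the momentum against a solenoidal test `φ = curl Ψ` is a VORTICITY MOMENT: `|M(t)| ≤ 4∫|Ψ||∇v(t)| ≤
4Kρ ∫_{B_ρ}|∇v(t)|` (`|Ψ| ≤ Kρ`), and Young's inequality turns the time-integrated bound into
`∫∫_{B_ρ}|∇v|² ≳ β²(s₂−s₁)³/(K²ρ⁵|B₁|)` — STRATEGY-CENSUS §F3 ("dissipation rate ≥ c b²(T−t)²ℓ⁻⁵"), as a theorem.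

References: L. D. Landau 1944; G. K. Batchelor 1967 §4.6; P. G. Lemarié-Rieusset 2016 (10.48).
-/

set_option linter.dupNamespace false

noncomputable section

open Filter Set Topology MeasureTheory Metric Function
open scoped ENNReal NNReal InnerProductSpace RealInnerProductSpace Laplacian ContDiff
open Literature.Analysis.FluidPDE

namespace Summit.NavierStokesRegularity.NavierStokesRegularity.Theorems

/-- The final algebra of the enstrophy floor: with `θ = βΔs/(32Kρ⁴|B₁|)`, the inequality
`(βΔs/8)(Δs/4) ≤ (2Kρ/θ) D + 2Kθρ⁴|B₁| (Δs/4)` gives `D ≥ β²Δs³/(4096 K² |B₁| ρ⁵)`. [folklore] -/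
theorem landauTail_shellEnstrophy_algebra {β K ρ V₁ Δs D θ : ℝ} (hβ : 0 < β) (hK : 0 < K) (hρ : 0 < ρ)
    (hV₁ : 0 < V₁) (hΔs : 0 < Δs) (hθ : θ = β * Δs / (32 * K * ρ ^ 4 * V₁))
    (hreal : β * Δs / 8 * (Δs / 4) ≤ 2 * K * ρ / θ * D + 2 * K * θ * ρ ^ 4 * V₁ * (Δs / 4)) :
    β ^ 2 / (4096 * K ^ 2 * V₁) * Δs ^ 3 / ρ ^ 5 ≤ D := by
  have e1 : 2 * K * θ * ρ ^ 4 * V₁ * (Δs / 4) = β * Δs ^ 2 / 64 := by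
    rw [hθ]; field_simp; ring
  have e2 : 2 * K * ρ / θ = 64 * K ^ 2 * ρ ^ 5 * V₁ / (β * Δs) := by
    rw [hθ]; field_simp; ring
  rw [e1, e2] at hreal
  have h3 : β * Δs ^ 2 / 64 ≤ 64 * K ^ 2 * ρ ^ 5 * V₁ / (β * Δs) * D := by linarith
  rw [div_mul_eq_mul_div, le_div_iff₀ (by positivity)] at h3
  -- `h3 : β Δs²/64 · (β Δs) ≤ 64 K² ρ⁵ V₁ D`
  rw [div_mul_eq_mul_div, div_le_iff₀ (by positivity)]
  have h4 : β ^ 2 * Δs ^ 3 ≤ 4096 * K ^ 2 * V₁ * (D * ρ ^ 5) := by nlinarith [h3]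
  rw [div_le_iff₀ (by positivity)]
  calc β ^ 2 * Δs ^ 3 ≤ 4096 * K ^ 2 * V₁ * (D * ρ ^ 5) := h4
    _ = D * ρ ^ 5 * (4096 * K ^ 2 * V₁) := by ring


/-- **L3 — SHELL THEOREM, enstrophy form** (registered support stub of crux stmt-NavierStokesRegularity-1944, lead c7;
Landau 1944, Batchelor 1967 §4.6, Lemarié-Rieusset 2016 (10.48)): there are `c, ε > 0` depending only on the
profile such that every classical unit-viscosity flow `v` on `ℝ³ × (−1,0)` which is `L²`-close to the Landau flow on
a shell, `∫_{s₁}^{s₂}∫_{ρ/2<|y|<ρ} |v − U|² ≤ ε ρ (s₂ − s₁)`, dissipates `∫_{s₁}^{s₂}∫_{B_ρ} |∇v|² ≥ c (s₂ − s₁)³ ρ⁻⁵`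
inside the shell (the momentum against a solenoidal test is a vorticity moment). [folklore] -/
theorem landauTail_shell_enstrophy_floor : ∀ (U : EuclideanSpace ℝ (Fin 3) → EuclideanSpace ℝ (Fin 3)) (P : EuclideanSpace ℝ (Fin 3) → ℝ), (ContDiffOn ℝ (⊤ : ℕ∞) U {0}ᶜ ∧ ContDiffOn ℝ (⊤ : ℕ∞) P {0}ᶜ ∧ (∀ x : EuclideanSpace ℝ (Fin 3), x ≠ 0 → Literature.Analysis.FluidPDE.convect U U x + gradient P x = (1 : ℝ) • Laplacian.laplacian U x) ∧ (∀ x : EuclideanSpace ℝ (Fin 3), x ≠ 0 → Literature.Analysis.FluidPDE.VectorCalculus.divergence U x = 0) ∧ (∀ c : ℝ, 0 < c → ∀ x : EuclideanSpace ℝ (Fin 3), U (c • x) = c⁻¹ • U x) ∧ (∃ x : EuclideanSpace ℝ (Fin 3), U x ≠ 0)) → ∃ c : ℝ, 0 < c ∧ ∃ ε : ℝ, 0 < ε ∧ ∀ (v : ℝ → EuclideanSpace ℝ (Fin 3) → EuclideanSpace ℝ (Fin 3)) (q : ℝ → EuclideanSpace ℝ (Fin 3) → ℝ), Literature.Analysis.FluidPDE.IsClassicalNSSolutionOn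 (Set.Ioo (-1) 0) 1 0 v q → ∀ ρ : ℝ, 0 < ρ → ρ ≤ 1 → ∀ s₁ s₂ : ℝ, -1 < s₁ → s₁ < s₂ → s₂ < 0 → (∫⁻ z in Set.Ioo s₁ s₂ ×ˢ (Metric.ball (0 : EuclideanSpace ℝ (Fin 3)) ρ \ Metric.closedBall (0 : EuclideanSpace ℝ (Fin 3)) (ρ / 2)), ‖v z.1 z.2 - U z.2‖ₑ ^ 2) ≤ ENNReal.ofReal (ε * ρ * (s₂ - s₁)) → ENNReal.ofReal (c * (s₂ - s₁) ^ 3 / ρ ^ 5) ≤ ∫⁻ z in Set.Ioo s₁ s₂ ×ˢ Metric.ball (0 : EuclideanSpace ℝ (Fin 3)) ρ, ENNReal.ofReal (Literature.Analysis.FluidPDE.frobeniusNormSq (fderiv ℝ (v z.1) z.2)) := by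
  intro U P hprof
  have hUc : ContinuousOn U {0}ᶜ := hprof.1.continuousOn
  obtain ⟨a, ha, β, hβ, L, hL, hlaw⟩ := landauTail_momentum_law U P hprof
  obtain ⟨K, hK0, hφfam⟩ := landauTail_exists_plateau_test a
  -- the unit-ball volume and the constants
  set V₁ : ℝ := (volume (ball (0 : EuclideanSpace ℝ (Fin 3)) 1)).toReal with hV₁_def
  have hV₁top : volume (ball (0 : EuclideanSpace ℝ (Fin 3)) 1) ≠ ⊤ := measure_ball_lt_top.ne
  have hV₁pos : 0 < V₁ := ENNReal.toReal_pos (measure_ball_pos volume 0 one_pos).ne' hV₁top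
  have hK1 : 1 ≤ K := by
    obtain ⟨φ, Ψ, -, -, -, -, hφa, -, -, hφK, -⟩ := hφfam 1 one_pos
    have h := hφK 0
    rwa [hφa 0 (mem_closedBall_self (by norm_num)), ha] at h
  have hKpos : 0 < K := one_pos.trans_le hK1
  set κ : ℝ := K * (1 + 4 * L) * (1 + V₁) / 2 + K with hκ_def
  have hκ : 0 ≤ κ := by positivity
  set η : ℝ := min 1 (β / (8 * (κ + 1))) with hη_def
  have hη0 : 0 < η := lt_min one_pos (by positivity)
  have hη1 : η ≤ 1 := min_le_left _ _
  have hηβ : η ≤ β / (8 * (κ + 1)) := min_le_right _ _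
  set c : ℝ := β ^ 2 / (4096 * K ^ 2 * V₁) with hc_def
  refine ⟨c, by positivity, η ^ 2, by positivity, ?_⟩
  intro v q hcl ρ hρ _hρ1 s₁ s₂ hs₁ hs₁₂ hs₂ hclose
  set Δs : ℝ := s₂ - s₁ with hΔs_def
  have hΔs : 0 < Δs := by rw [hΔs_def]; linarith
  obtain ⟨φ, Ψ, hφs, -, hφsupp, hφdiv, hφa, hφD0, hφΔ0, -, hφD, hφΔ, hΨs, hΨc, hΨsupp, hφcurl, hΨK⟩ := hφfam ρ hρ
  obtain ⟨hder, hcont, herr⟩ := hlaw v q hcl ρ K φ hρ hK0 hφs hφsupp hφdiv hφa hφD0 hφΔ0 hφD hφΔ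
  set M : ℝ → ℝ := fun s => ∫ x, ⟪v s x, φ x⟫ with hM_def
  set Fl : ℝ → ℝ := fun t => ∫ x, (⟪v t x, convect (v t) φ x⟫ + ⟪v t x, Δ φ x⟫) with hFl_def
  set I : Set ℝ := Ioo s₁ s₂ with hI_def
  set B : Set (EuclideanSpace ℝ (Fin 3)) := ball (0 : EuclideanSpace ℝ (Fin 3)) ρ with hB_def
  have hIsub : I ⊆ Ioo (-1 : ℝ) 0 := fun t ht => ⟨hs₁.trans ht.1, ht.2.trans hs₂⟩
  have hIcc : Icc s₁ s₂ ⊆ Ioo (-1 : ℝ) 0 := fun t ht => ⟨hs₁.trans_le ht.1, ht.2.trans_lt hs₂⟩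
  -- the integrated error `∫_I |Fl + β| ≤ β Δs / 8` (Young with `γ = η/ρ`, shell defect `d = η² ρ Δs`)
  have hA₁ : 0 ≤ K / ρ ^ 2 * (1 + 4 * L) := by positivity
  have hA₂ : 0 ≤ K / ρ := by positivity
  have hγ : 0 < η / ρ := by positivity
  have herrI := landauTail_shell_error_integral (F := Fl) (γ := η / ρ) (d := η ^ 2 * ρ * (s₂ - s₁)) hUc hcl hρ
    hA₁ hA₂ hcont herr hs₁ hs₁₂ hs₂ hγ (by positivity) hclose
  have habs_int : ∫ t in I, |Fl t + β| ≤ β * Δs / 8 := by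
    refine herrI.trans ?_
    rw [← hV₁_def, ← hΔs_def]
    have e1 : K / ρ ^ 2 * (1 + 4 * L) * (1 / (2 * (η / ρ)) * (η ^ 2 * ρ * Δs)) =
        K * (1 + 4 * L) * η * Δs / 2 := by field_simp
    have e2 : K / ρ ^ 2 * (1 + 4 * L) * (η / ρ / 2 * (ρ ^ 3 * V₁) * Δs) =
        K * (1 + 4 * L) * V₁ * η * Δs / 2 := by field_simp
    have e3 : K / ρ * (η ^ 2 * ρ * Δs) = K * η ^ 2 * Δs := by field_simp
    have hη2 : K * η ^ 2 * Δs ≤ K * η * Δs := by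
      have hη' : η ^ 2 ≤ η := pow_le_of_le_one hη0.le hη1 two_ne_zero
      have hKΔ : 0 ≤ K * Δs := by positivity
      calc K * η ^ 2 * Δs = K * Δs * η ^ 2 := by ring
        _ ≤ K * Δs * η := mul_le_mul_of_nonneg_left hη' hKΔ
        _ = K * η * Δs := by ring
    have hmain : K * (1 + 4 * L) * η * Δs / 2 + K * (1 + 4 * L) * V₁ * η * Δs / 2 + K * η * Δs
        = κ * η * Δs := by rw [hκ_def]; ring
    have hfin : κ * η * Δs ≤ β * Δs / 8 := by
      have h1 : κ * η ≤ κ * (β / (8 * (κ + 1))) := mul_le_mul_of_nonneg_left hηβ hκ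
      have h2 : κ * (β / (8 * (κ + 1))) ≤ β / 8 := by
        rw [mul_div_assoc', div_le_div_iff₀ (by positivity) (by norm_num : (0 : ℝ) < 8)]
        have : 0 ≤ β * 8 := by positivity
        nlinarith [this]
      have h3 : κ * η * Δs ≤ β / 8 * Δs := mul_le_mul_of_nonneg_right (h1.trans h2) hΔs.le
      linarith [h3]
    rw [mul_add, e1, e2, e3]
    linarith [hmain, hη2, hfin]
  -- the quarter-window `J` with `|M| ≥ β Δs / 8`
  have hline : ∀ t ∈ Icc s₁ s₂, |M t - (M s₁ - β * (t - s₁))| ≤ β * (s₂ - s₁) / 8 := fun t ht =>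
    landauTail_shellEnstrophy_line (M := M) (F := Fl) hs₁₂ (fun u hu => hder u (hIcc hu)) (hcont.mono hIcc)
      habs_int ht
  obtain ⟨J, hJm, hJsub, hvolJ, hJM⟩ := landauTail_shellEnstrophy_quarter (M := M) hs₁₂ hβ hline
  have hJI : J ⊆ I := hJsub
  have hJsub' : J ⊆ Ioo (-1 : ℝ) 0 := hJI.trans hIsub
  -- the dissipation integrand and its measurability
  have hDc : ContinuousOn (fun z : ℝ × EuclideanSpace ℝ (Fin 3) => fderiv ℝ (v z.1) z.2)
      (Ioo (-1 : ℝ) 0 ×ˢ univ) :=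
    continuousOn_fderiv_slice_of_contDiffOn (hcl.smooth_velocity.of_le (by exact_mod_cast le_top))
      isOpen_Ioo.uniqueDiffOn
  set Φ : ℝ × EuclideanSpace ℝ (Fin 3) → ℝ≥0∞ := fun z => ENNReal.ofReal (frobeniusNormSq (fderiv ℝ (v z.1) z.2))
    with hΦ_def
  have hΦc : ContinuousOn Φ (Ioo (-1 : ℝ) 0 ×ˢ univ) :=
    ENNReal.continuous_ofReal.comp_continuousOn
      (landauTail_shellEnstrophy_continuous_frobeniusNormSq.comp_continuousOn hDc)
  have hJBsub : J ×ˢ B ⊆ Ioo (-1 : ℝ) 0 ×ˢ univ := prod_mono hJsub' (subset_univ _)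
  have hJBm : MeasurableSet (J ×ˢ B) := hJm.prod measurableSet_ball
  have hΦm : AEMeasurable Φ ((volume.restrict J).prod (volume.restrict B)) := by
    rw [Measure.prod_restrict, ← Measure.volume_eq_prod]
    exact ((hΦc.mono hJBsub).aestronglyMeasurable hJBm).aemeasurable
  set GD : ℝ → ℝ≥0∞ := fun t => ∫⁻ x in B, Φ (t, x) with hGD_def
  have hGDm : AEMeasurable GD (volume.restrict J) := hΦm.lintegral_prod_right'
  -- `∫_J GD ≤ D := ∫∫_{I×B} |∇v|²`
  set D : ℝ≥0∞ := ∫⁻ z in I ×ˢ B, Φ z with hD_def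
  have hJD : ∫⁻ t in J, GD t ≤ D := by
    have h := setLIntegral_prod (μ := (volume : Measure ℝ)) (ν := (volume : Measure (EuclideanSpace ℝ (Fin 3))))
      (s := J) (t := B) Φ (by rw [← Measure.prod_restrict]; exact hΦm)
    rw [← Measure.volume_eq_prod] at h
    rw [hGD_def, ← h, hD_def]
    exact lintegral_mono_set (prod_mono hJI Subset.rfl)
  -- the per-time vorticity bound: `ofReal |M t| ≤ ofReal (2Kρ/θ) * GD t + ofReal (2Kθρ⁴V₁)`
  set θ : ℝ := β * Δs / (32 * K * ρ ^ 4 * V₁) with hθ_def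
  have hθ : 0 < θ := by positivity
  have hΨ2 : ContDiff ℝ 2 Ψ := contDiff_infty.1 hΨs 2
  have hMt : ∀ t ∈ J, ENNReal.ofReal |M t| ≤ ENNReal.ofReal (2 * K * ρ / θ) * GD t +
      ENNReal.ofReal (2 * K * θ * ρ ^ 4 * V₁) := by
    intro t ht
    have ht' : t ∈ Ioo (-1 : ℝ) 0 := hJsub' ht
    have hv1 : ContDiff ℝ 1 (v t) := (hcl.contDiff_velocity ht').of_le (by exact_mod_cast le_top)
    have hmom := landauTail_shellEnstrophy_moment_le (θ := θ) hv1 hΨ2 hΨc hΨsupp hΨK hK0 hρ hθ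
    have hMeq : M t = ∫ x, ⟪v t x, curl Ψ x⟫ := by
      rw [hM_def]
      exact integral_congr_ae (Eventually.of_forall fun x => by simp only [hφcurl x])
    have hFc : Continuous fun x => frobeniusNormSq (fderiv ℝ (v t) x) :=
      landauTail_shellEnstrophy_continuous_frobeniusNormSq.comp (hv1.continuous_fderiv one_ne_zero)
    have hFint : IntegrableOn (fun x => frobeniusNormSq (fderiv ℝ (v t) x)) B volume :=
      (hFc.continuousOn.integrableOn_compact (isCompact_closedBall 0 ρ)).mono_set ball_subset_closedBall
    have hi0 : 0 ≤ ∫ x in B, frobeniusNormSq (fderiv ℝ (v t) x) :=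
      integral_nonneg fun x => frobeniusNormSq_nonneg _
    have hGD : ENNReal.ofReal (∫ x in B, frobeniusNormSq (fderiv ℝ (v t) x)) = GD t := by
      rw [hGD_def, ofReal_integral_eq_lintegral_ofReal hFint (Eventually.of_forall fun x => frobeniusNormSq_nonneg _)]
    rw [hMeq]
    calc ENNReal.ofReal |∫ x, ⟪v t x, curl Ψ x⟫|
        ≤ ENNReal.ofReal (2 * K * ρ / θ * (∫ x in B, frobeniusNormSq (fderiv ℝ (v t) x)) +
            2 * K * θ * ρ ^ 4 * V₁) := ENNReal.ofReal_le_ofReal hmom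
      _ = ENNReal.ofReal (2 * K * ρ / θ) * GD t + ENNReal.ofReal (2 * K * θ * ρ ^ 4 * V₁) := by
          rw [ENNReal.ofReal_add (by positivity) (by positivity), ENNReal.ofReal_mul (by positivity), hGD]
  -- integrate over `J`
  have hlow : ENNReal.ofReal (β * Δs / 8) * ENNReal.ofReal (Δs / 4) ≤
      ENNReal.ofReal (2 * K * ρ / θ) * D + ENNReal.ofReal (2 * K * θ * ρ ^ 4 * V₁) * ENNReal.ofReal (Δs / 4) := by
    calc ENNReal.ofReal (β * Δs / 8) * ENNReal.ofReal (Δs / 4)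
        = ∫⁻ t in J, ENNReal.ofReal (β * Δs / 8) := by rw [setLIntegral_const, hvolJ, hΔs_def]
      _ ≤ ∫⁻ t in J, ENNReal.ofReal |M t| :=
          setLIntegral_mono' hJm fun t ht => ENNReal.ofReal_le_ofReal (by rw [hΔs_def]; exact hJM t ht)
      _ ≤ ∫⁻ t in J, (ENNReal.ofReal (2 * K * ρ / θ) * GD t + ENNReal.ofReal (2 * K * θ * ρ ^ 4 * V₁)) :=
          setLIntegral_mono' hJm hMt
      _ = ENNReal.ofReal (2 * K * ρ / θ) * (∫⁻ t in J, GD t) +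
            ENNReal.ofReal (2 * K * θ * ρ ^ 4 * V₁) * volume J := by
          rw [lintegral_add_right _ measurable_const, lintegral_const_mul'' _ hGDm, setLIntegral_const]
      _ ≤ _ := by
          rw [hvolJ, hΔs_def]
          gcongr
  -- conclude: either `D = ⊤` or the real inequality gives `D ≥ c Δs³ / ρ⁵`
  rcases eq_or_ne D ⊤ with hDtop | hDtop
  · rw [hDtop]; exact le_top
  have hDeq : D = ENNReal.ofReal D.toReal := (ENNReal.ofReal_toReal hDtop).symm
  have hreal : β * Δs / 8 * (Δs / 4) ≤ 2 * K * ρ / θ * D.toReal + 2 * K * θ * ρ ^ 4 * V₁ * (Δs / 4) := by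
    rw [hDeq, ← ENNReal.ofReal_mul (by positivity), ← ENNReal.ofReal_mul (by positivity),
      ← ENNReal.ofReal_mul (by positivity), ← ENNReal.ofReal_add (by positivity) (by positivity)] at hlow
    exact (ENNReal.ofReal_le_ofReal_iff (by positivity)).1 hlow
  have hfin := landauTail_shellEnstrophy_algebra hβ hKpos hρ hV₁pos hΔs hθ_def hreal
  rw [hDeq]
  refine ENNReal.ofReal_le_ofReal ?_
  rw [hc_def]
  exact hfin

end Summit.NavierStokesRegularity.NavierStokesRegularity.Theorems

end
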